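import Summits.BirchSwinnertonDyer.BirchSwinnertonDyer.Theorems.TwoAdicConverseOrdLambdaHalfAtTwoGreenbergGL1OfPrint
import Literature.NumberTheory.EllipticCurves.GreenbergSelmerDualDataExistsProofs
import Literature.NumberTheory.EllipticCurves.IwasawaSelmerControlCokerProofs
import Literature.NumberTheory.EllipticCurves.FineSelmerTorsionCoefficientsFiniteProofs
import HarnessLib

/-!
# Route `TwoAdicConverse` (rung S3), crux `OrdLambdaHalfAtTwo` (item stmt-BirchSwinnertonDyer-19556), line
# `kato-determinant-greenberg-two`: DESCENT of classes of `H¹(K_∞, M)` to a finite layer `K_n` (first brick C0-a towards the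
# `w̄`-step stub `stub_wbarStepAtTwo`)

Cell `bsd-2adic`, seat `bsd-2adic-conv-1` GEN 25 (`--supports` stmt-BirchSwinnertonDyer-19556 `--as helper`; pen RC-318 (c) «movable stub today
= `stub_wbarStepAtTwo` [C] via conv-1 modulo the tree's CFT facts»; design memo NOTE-19556-GL1res-conv1-g25-ADDENDUM-1 §C, step C0).
The `w̄`-step [C] speaks of classes of `H¹(Gal(K̄/K_∞), M)`; its classical proof (NOTE §1 (a)) and any class-field-theoretic
kernelization start by DESCENDING such a class to a finite layer `K_n` of the `ℤ_p`-tower.  This file supplies that descent for ANY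
number field `K`, ANY `ℤ_p`-extension `κ` with a topological generator `γ`, and ANY discrete `p`-primary `Γ_K`-module `M` with open
stabilisers (e.g. finite with trivial action), by composing tree theorems:

* `exists_forall_conjH1_eq_of_kappa_mem` — (A1)+(A2), GLOBAL form: every class `c ∈ H¹(ker κ, M)` is fixed by `conj_g` for every
  `g ∈ Γ_K` with `κ g ∈ p^t ℤ_p`, for some `t` (open stabiliser `GreenbergSelmer.exists_openNormalSubgroup_conjH1_eq`; the image of an
  open normal subgroup under `κ` is closed of finite index in `ℤ_p`, hence contains `p^t ℤ_p` —
  `FineSelmerCoefficientMap.pow_valuation_mul_mem_of_isClosed`; `g = τ · h` with `τ` in the stabiliser and `h ∈ ker κ`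
  acting trivially, `conjH1_of_mem_holds`);
* **`exists_layer_resOfLe_eq`** — hence `c` is `conj_{γ^{p^t}}`-fixed and, by Greenberg's Lemma 3.2 at layer `t` (tree
  `ZpExtension.mem_range_resOfLe_of_conjH1_eq`, the `cd_p ℤ_p = 1` cocycle argument), **`c` is the restriction of a class of
  `H¹(Gal(K̄/K_t), M)`** (`K_t` = the `t`-th layer, `κ.layerSubgroup t`);
* `exists_layer_resOfLe_eq_of_trivial` — the case of a finite `M` of `p`-power order with trivial action (the residual modules
  `Φ ≅ 𝔽₂` of the line).

HONEST FRAMING.  Composition of tree theorems; no definition, no named fact, no `sorry`; this is infrastructure toward [C], which stays a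
registered stub; BSD is not proved by any of this.  PARTITION (D-0054): none — RANK axis S3 × X5@2 stratum (β); types-the-object-of.

References: R. Greenberg, LNM 1716 (1999) §1 (after Conj. 1.3), §3 Lemma 3.2 [GreenbergLNM1716]; J.-P. Serre, *Galois Cohomology* I §2.6
[SerreGaloisCohomology1997]; Neukirch–Schmidt–Wingberg (1.6.7) [NeukirchSchmidtWingberg2008].
-/

set_option linter.dupNamespace false
set_option autoImplicit false

noncomputable section

open scoped Classical

namespace Summit.BirchSwinnertonDyer.BirchSwinnertonDyer.Theorems.TwoAdicGreenbergCotorsion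

open NumberField IsDedekindDomain Field
open Literature.NumberTheory.EllipticCurves Literature.NumberTheory.EllipticCurves.GreenbergSelmer
  Literature.NumberTheory.GaloisRepresentations

variable {K : Type} [Field K] [NumberField K] {p : ℕ} [Fact p.Prime] (κ : ZpExtension K p)
  (M : Type) [AddCommGroup M] [DistribMulAction (absoluteGaloisGroup K) M] [TopologicalSpace M] [DiscreteTopology M]

/-- **(A1)+(A2), global form.**  For a discrete `Γ_K`-module `M` with open stabilisers and a class `c ∈ H¹(Gal(K̄/K_∞), M)` there is
`t` such that `conj_g c = c` for EVERY `g ∈ Γ_K` with `κ g ∈ p^t ℤ_p`: the open normal stabiliser `𝒩` of `c`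
(`exists_openNormalSubgroup_conjH1_eq`) has image `κ(𝒩) ⊇ p^t ℤ_p` (closed, and not `{0}` since `Γ_K/𝒩` is finite while `ℤ_p` is
not), and `g = τ h` with `τ ∈ 𝒩`, `h ∈ ker κ` (inner, `conjH1_of_mem_holds`). [cite: GreenbergLNM1716, §1 (after Conj. 1.3)] -/
theorem exists_forall_conjH1_eq_of_kappa_mem
    (hstab : ∀ m : M, IsOpen (MulAction.stabilizer (absoluteGaloisGroup K) m : Set (absoluteGaloisGroup K)))
    (c : subgroupH1 κ.kerSubgroup M) :
    ∃ t : ℕ, ∀ (g : absoluteGaloisGroup K) (z : ℤ_[p]),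
      κ g = Multiplicative.ofAdd ((p : ℤ_[p]) ^ t * z) → conjH1 κ.kerSubgroup M g c = c := by
  obtain ⟨Nrm, hNrm⟩ := GreenbergSelmer.exists_openNormalSubgroup_conjH1_eq κ M hstab c
  -- the image `Z = κ(𝒩)`, a closed subgroup of `ℤ_p`
  let Z : AddSubgroup ℤ_[p] :=
    AddSubgroup.toSubgroup.symm ((Nrm : Subgroup (absoluteGaloisGroup K)).map
      (κ.toContinuousMonoidHom : absoluteGaloisGroup K →* Multiplicative ℤ_[p]))
  have hZmem : ∀ y : ℤ_[p], y ∈ Z ↔ ∃ τ ∈ (Nrm : Subgroup (absoluteGaloisGroup K)), κ τ = Multiplicative.ofAdd y :=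
    fun y ↦ by
      change Multiplicative.ofAdd y ∈ (Nrm : Subgroup (absoluteGaloisGroup K)).map _ ↔ _
      rw [Subgroup.mem_map]
      rfl
  have hZclosed : IsClosed (Z : Set ℤ_[p]) := by
    have hc : IsCompact ((((Nrm : Subgroup (absoluteGaloisGroup K)).map
        (κ.toContinuousMonoidHom : absoluteGaloisGroup K →* Multiplicative ℤ_[p]) :
        Subgroup (Multiplicative ℤ_[p])) : Set (Multiplicative ℤ_[p]))) := by
      rw [Subgroup.coe_map]
      exact ((Subgroup.isClosed_of_isOpen _ Nrm.isOpen').isCompact).image κ.toContinuousMonoidHom.continuous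
    exact hc.isClosed
  -- `𝒩 ⊄ ker κ`: otherwise `ℤ_p`, the image of the finite `Γ_K / 𝒩`, would be finite
  have hex : ∃ τ₀ ∈ (Nrm : Subgroup (absoluteGaloisGroup K)), κ τ₀ ≠ 1 := by
    by_contra hall
    push Not at hall
    haveI : Finite (absoluteGaloisGroup K ⧸ (Nrm : Subgroup (absoluteGaloisGroup K))) :=
      Subgroup.quotient_finite_of_isOpen _ Nrm.isOpen'
    have hle : (Nrm : Subgroup (absoluteGaloisGroup K)) ≤
        (κ.toContinuousMonoidHom : absoluteGaloisGroup K →* Multiplicative ℤ_[p]).ker := fun τ hτ ↦ hall τ hτ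
    let f : absoluteGaloisGroup K ⧸ (Nrm : Subgroup (absoluteGaloisGroup K)) →* Multiplicative ℤ_[p] :=
      QuotientGroup.lift _ (κ.toContinuousMonoidHom : absoluteGaloisGroup K →* Multiplicative ℤ_[p]) hle
    have hf : Function.Surjective f := by
      intro y
      obtain ⟨g, hg⟩ := κ.surjective y
      exact ⟨QuotientGroup.mk g, hg⟩
    haveI : Finite (Multiplicative ℤ_[p]) := Finite.of_surjective f hf
    haveI : Finite ℤ_[p] := Finite.of_equiv _ Multiplicative.toAdd
    exact not_finite ℤ_[p]
  obtain ⟨τ₀, hτ₀N, hτ₀⟩ := hex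
  set u : ℤ_[p] := (κ τ₀).toAdd with hudef
  have hu0 : u ≠ 0 := fun h ↦ hτ₀ (Multiplicative.toAdd.injective h)
  have huZ : u ∈ Z := (hZmem u).mpr ⟨τ₀, hτ₀N, by rw [hudef, ofAdd_toAdd]⟩
  refine ⟨u.valuation, fun g z hz ↦ ?_⟩
  obtain ⟨τ, hτN, hτ⟩ := (hZmem _).mp
    (FineSelmerCoefficientMap.pow_valuation_mul_mem_of_isClosed Z hZclosed huZ hu0 z)
  have hh : τ⁻¹ * g ∈ κ.kerSubgroup := by
    rw [ZpExtension.mem_kerSubgroup, map_mul, map_inv, hτ, hz, inv_mul_cancel]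
  rw [show g = τ * (τ⁻¹ * g) by group, conjH1_mul_holds, AddMonoidHom.comp_apply,
    conjH1_of_mem_holds κ.kerSubgroup M hh, AddMonoidHom.id_apply, hNrm τ hτN]

/-- **Descent to a finite layer.**  For a `ℤ_p`-extension `κ` with topological generator `γ` and a discrete `p`-primary `Γ_K`-module `M`
with open stabilisers and continuous orbit maps, every class of `H¹(Gal(K̄/K_∞), M)` is the restriction of a class of
`H¹(Gal(K̄/K_n), M)` for some `n` (it is `conj_{γ^{p^n}}`-fixed by `exists_forall_conjH1_eq_of_kappa_mem`, and Greenberg's Lemma 3.2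
at layer `n`, `ZpExtension.mem_range_resOfLe_of_conjH1_eq`, lifts it). [cite: GreenbergLNM1716, §3 Lemma 3.2]
[cite: SerreGaloisCohomology1997, I.§2.6] -/
theorem exists_layer_resOfLe_eq {γ : absoluteGaloisGroup K} (hγ : κ.IsTopGenerator γ)
    (hstab : ∀ m : M, IsOpen (MulAction.stabilizer (absoluteGaloisGroup K) m : Set (absoluteGaloisGroup K)))
    (hcont : ∀ m : M, Continuous fun g : absoluteGaloisGroup K ↦ g • m)
    (hprim : ∀ m : M, ∃ k : ℕ, p ^ k • m = 0) (c : subgroupH1 κ.kerSubgroup M) :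
    ∃ (n : ℕ) (c' : subgroupH1 (κ.layerSubgroup n) M), resOfLe M (κ.kerSubgroup_le_layerSubgroup n) c' = c := by
  obtain ⟨t, ht⟩ := exists_forall_conjH1_eq_of_kappa_mem κ M hstab c
  have hfix : conjH1 κ.kerSubgroup M (γ ^ p ^ t) c = c := by
    refine ht _ 1 ?_
    rw [map_pow, hγ, mul_one, ← ofAdd_nsmul, nsmul_eq_mul, mul_one, Nat.cast_pow]
  obtain ⟨c', hc'⟩ := ZpExtension.mem_range_resOfLe_of_conjH1_eq κ hγ t hcont hprim c hfix
  exact ⟨t, c', hc'⟩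

/-- **Descent to a finite layer, trivial finite coefficients** (the residual modules of the line: `#M = p^k`, trivial action).
[cite: GreenbergLNM1716, §3 Lemma 3.2] -/
theorem exists_layer_resOfLe_eq_of_trivial {γ : absoluteGaloisGroup K} (hγ : κ.IsTopGenerator γ) [Finite M]
    (hM : ∃ k : ℕ, Nat.card M = p ^ k) (htriv : ∀ (σ : absoluteGaloisGroup K) (m : M), σ • m = m)
    (c : subgroupH1 κ.kerSubgroup M) :
    ∃ (n : ℕ) (c' : subgroupH1 (κ.layerSubgroup n) M), resOfLe M (κ.kerSubgroup_le_layerSubgroup n) c' = c := by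
  refine exists_layer_resOfLe_eq κ M hγ (fun m ↦ ?_) (fun m ↦ ?_) (fun m ↦ ?_) c
  · have : (MulAction.stabilizer (absoluteGaloisGroup K) m : Set (absoluteGaloisGroup K)) = Set.univ :=
      Set.eq_univ_of_forall fun σ ↦ htriv σ m
    rw [this]; exact isOpen_univ
  · have : (fun g : absoluteGaloisGroup K ↦ g • m) = fun _ ↦ m := funext fun g ↦ htriv g m
    rw [this]; exact continuous_const
  · obtain ⟨k, hk⟩ := hM
    exact ⟨k, by rw [← hk]; exact card_nsmul_eq_zero'⟩

end Summit.BirchSwinnertonDyer.BirchSwinnertonDyer.Theorems.TwoAdicGreenbergCotorsion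

end
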